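import Summits.Ventures.PercRepro.ProfilePointedCircuitClassesTop

/-!
# PercRepro — THE BOTTOM-LEVEL PER-CIRCUIT CLAIM AT NULLITY 5, I: THE CLASSES `#C = 5` AND `#C = 4`, AND THE RANK TOOLS
(p5, gen 37; `proofs/P5-GM1.md` §53(e) — the nullity-5 chain built on the nullity-4 modules
`ProfilePointedCircuitClasses*` of gen 36)

On a matroid with `#E = ρ(E) + 5` and `ρ(E) ≥ 7` the bottom level is `5` and its mirror level is `n − 6`.  This module
gives the two classes that need no injection — `#C = 5` (`Δ ≤ 1 ≤ U`: the only captured `5`-set of the class is `C`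
itself, and a basis `J ⊇ C` of `E − x` minus a point of `J ∖ C` is a unit) and `#C = 4` (the double counting of the
containment edges demand ⊆ unit with the uniform bound `ρ − 5`) — together with the rank tool the class `#C = 3`
needs, `exists_not_coloop_of_five` (a `5`-set `T ⊆ X` with `ρ(X ∖ T) + 3 ≥ ρ(X)` has a point that is not a coloop of
`X`).  The classes `#C ≥ 6` are empty (`gammaC_eq_zero_of_lt_card`) and `#C = 0` is empty
(`gammaC_eq_zero_of_card_eq_zero`); `#C = 3`, `#C = 1` and `#C = 2` are in the sister modules.
-/

open scoped Matroid

namespace PercRepro.Cogirth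

open Finset ThmH Skew Shadow Profile

variable {α : Type} [DecidableEq α] {N : Matroid α} [N.Finite]

section Five

/-- In a `5`-set `T ⊆ X` with `ρ(X ∖ T) + 3 ≥ ρ(X)`, some point is not a coloop of `X` (indeed at most three are). -/
theorem exists_not_coloop_of_five {X T : Finset α} (hT : T ⊆ X) (hT5 : T.card = 5)
    (hrk : rk N X ≤ rk N (X \ T) + 3) : ∃ t ∈ T, rk N (X.erase t) = rk N X := by
  by_contra h
  have hall : ∀ t ∈ T, rk N (X.erase t) < rk N X := by
    intro t ht
    have h1 : rk N (X.erase t) ≤ rk N X := rk_le_rk_of_subset_finset (erase_subset t X)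
    exact lt_of_le_of_ne h1 (fun heq => h ⟨t, ht, heq⟩)
  have := rk_sdiff_add_card_le_of_forall_coloop T hT hall
  omega

/-- **THE CLASS `#C = 5`** (`#(C ∪ x) = 6`; §52(b): `Δ ≤ 1 ≤ U`): at most one captured `5`-set (`W = C` itself), and
if it is there then so is a captured `(n − 6)`-set of the class — a basis `J ⊇ W` of `E − x` minus a point of
`J ∖ W` (p10's `exists_mem_capLevel_superset` and the superset lemma). -/
theorem gammaC_five_le_of_card_eq_five (hn : (gr N).card = rk N (gr N) + 5) (hR : 7 ≤ rk N (gr N))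
    (x : α) {C : Finset α} (hC : C.card = 5) : gammaC N 5 x C ≤ gammaC N ((gr N).card - 6) x C := by
  unfold gammaC
  -- every captured `5`-set of the class is `C` itself
  have hsub : ∀ W ∈ (biIndepSets N 5).filter (fun W => x ∉ W ∧ x ∈ clF N W ∧ fundC N W x = C), W = C := by
    intro W hW
    have h1 : C ⊆ W := subset_of_mem_gammaC_filter hW
    have h2 : W.card = 5 := (mem_biIndepSets.1 (mem_filter.1 hW).1).2.1
    exact (eq_of_subset_of_card_le h1 (by omega)).symm
  rcases ((biIndepSets N 5).filter (fun W => x ∉ W ∧ x ∈ clF N W ∧ fundC N W x = C)).eq_empty_or_nonempty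
    with hemp | ⟨W, hW⟩
  · rw [hemp, card_empty]
    exact Nat.zero_le _
  have hle : ((biIndepSets N 5).filter (fun W => x ∉ W ∧ x ∈ clF N W ∧ fundC N W x = C)).card ≤ 1 :=
    card_le_one.2 (fun a ha b hb => by rw [hsub a ha, hsub b hb])
  have hWC := hsub W hW
  subst hWC
  rw [mem_filter, mem_biIndepSets] at hW
  obtain ⟨⟨hWg, hWcard, hWrk, hWcompl⟩, hxW, hxcl, hfund⟩ := hW
  -- `W` is captured at the level `5`; take a captured superset at the level `n − 5` and drop a point of it
  have hWcap : W ∈ capLevel N x 5 := by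
    rw [mem_capLevel, mem_capSets, mem_biIndepAll]
    exact ⟨⟨⟨⟨hWg, hWrk, hWcompl⟩, hxW⟩, hxcl⟩, hWcard⟩
  obtain ⟨X', hX', hWX'⟩ := exists_mem_capLevel_superset (M := N) (p := x) (k := 5) (by omega) hWcap
  rw [mem_capLevel, mem_capSets, mem_biIndepAll] at hX'
  obtain ⟨⟨⟨⟨hX'g, hX'rk, hX'compl⟩, hxX'⟩, hxclX'⟩, hX'card⟩ := hX'
  have hlt : W.card < X'.card := by omega
  obtain ⟨u, huX', huW⟩ := exists_mem_notMem_of_card_lt_card hlt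
  -- the target `V := X' − u`
  set V := X'.erase u with hV
  have hVX' : V ⊆ X' := erase_subset u X'
  have hWV : W ⊆ V := by
    intro w hw
    rw [hV, mem_erase]
    exact ⟨fun h => huW (h ▸ hw), hWX' hw⟩
  have hVg : V ⊆ gr N := hVX'.trans hX'g
  have hVcard : V.card = (gr N).card - 6 := by
    rw [hV, card_erase_of_mem huX', hX'card]
    omega
  have hVrk : rk N V = V.card := rk_eq_card_of_subset_of_rk_eq_card hVX' hX'rk
  have hVcompl : rk N (gr N \ V) = (gr N \ V).card :=
    rk_eq_card_of_subset_of_rk_eq_card (sdiff_subset_sdiff (Subset.refl _) hWV) hWcompl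
  have hxV : x ∉ V := fun h => hxX' (hVX' h)
  have hxclV : x ∈ clF N V := mem_clF_of_subset hWV hxcl
  have hfundV : fundC N V x = W :=
    fundC_eq_of_subset hWg hWrk hxcl hfund (hfund ▸ hxcl) hWV hVg hVrk hxclV
  -- hence the level-`(n − 6)` class is non-empty
  have hpos : 0 < ((biIndepSets N ((gr N).card - 6)).filter
      (fun Y => x ∉ Y ∧ x ∈ clF N Y ∧ fundC N Y x = W)).card :=
    card_pos.2 ⟨V, mem_filter.2 ⟨mem_biIndepSets.2 ⟨hVg, hVcard, hVrk, hVcompl⟩, hxV, hxclV, hfundV⟩⟩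
  omega

/-- **THE CLASS `#C = 4`** (`#(C ∪ x) = 5`; §52(b), the `#D = 5` case, as a double counting of the containment edges
demand ⊆ unit with the uniform bound `ρ − 5`): every demand `W = C + p` has at least `ρ − 5` units above it
(`J − b`, `b ∈ J ∖ W`, for a basis `J ⊇ W` of `E − x`), every unit `V` has at most `ρ − 5` demands below it
(`W ↦ W ∖ C`, a point of `V ∖ C`), so `(ρ − 5)·Δ ≤ #edges ≤ (ρ − 5)·U`. -/
theorem gammaC_five_le_of_card_eq_four (hn : (gr N).card = rk N (gr N) + 5) (hR : 7 ≤ rk N (gr N))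
    (x : α) {C : Finset α} (hC : C.card = 4) : gammaC N 5 x C ≤ gammaC N ((gr N).card - 6) x C := by
  unfold gammaC
  set D := (biIndepSets N 5).filter (fun W => x ∉ W ∧ x ∈ clF N W ∧ fundC N W x = C) with hD
  set U := (biIndepSets N ((gr N).card - 6)).filter (fun V => x ∉ V ∧ x ∈ clF N V ∧ fundC N V x = C) with hU
  -- every demand `W = C + p` has at least `ρ − 5` units above it: `J − b`, `b ∈ J ∖ W`, for a basis `J ⊇ W` of `E − x`
  have hdeg : ∀ W ∈ D, rk N (gr N) - 5 ≤ (U.filter (fun V => W ⊆ V)).card := by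
    intro W hW
    rw [hD, mem_filter, mem_biIndepSets] at hW
    obtain ⟨⟨hWg, hWcard, hWrk, hWcompl⟩, hxW, hxcl, hfund⟩ := hW
    have hCW : C ⊆ W := hfund ▸ fundC_subset W x
    obtain ⟨p, hpW, hpC⟩ := exists_mem_notMem_of_card_lt_card (show C.card < W.card by omega)
    have hWe : W.erase p = C := by
      apply (eq_of_subset_of_card_le _ _).symm
      · intro c hc
        rw [mem_erase]
        exact ⟨fun h => hpC (h ▸ hc), hCW hc⟩
      · rw [card_erase_of_mem hpW]
        omega
    have hxC : x ∈ clF N C := by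
      have hpf : p ∉ fundC N W x := by rw [hfund]; exact hpC
      unfold fundC at hpf
      rw [mem_filter, not_and] at hpf
      have h := not_not.1 (hpf hpW)
      rw [hWe] at h
      exact h
    obtain ⟨J, hWJ, hJE, hJrk, hJcard⟩ := exists_indep_erase_superset_card_rk hWg hWrk hxW hxcl
    have hJg : J ⊆ gr N := hJE.trans (erase_subset _ _)
    have hxJ : x ∉ J := fun h => (mem_erase.1 (hJE h)).1 rfl
    have hmaps : ∀ b ∈ J \ W, J.erase b ∈ U.filter (fun V => W ⊆ V) := by
      intro b hb
      rw [mem_sdiff] at hb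
      have hWV : W ⊆ J.erase b := by
        intro w hw
        rw [mem_erase]
        exact ⟨fun h => hb.2 (h ▸ hw), hWJ hw⟩
      have hVg : J.erase b ⊆ gr N := (erase_subset _ _).trans hJg
      have hVrk : rk N (J.erase b) = (J.erase b).card := rk_eq_card_of_subset_of_rk_eq_card (erase_subset _ _) hJrk
      have hxV : x ∉ J.erase b := fun h => hxJ (erase_subset _ _ h)
      have hxclV : x ∈ clF N (J.erase b) := mem_clF_of_subset hWV hxcl
      rw [mem_filter, hU, mem_filter, mem_biIndepSets]
      refine ⟨⟨⟨hVg, ?_, hVrk, ?_⟩, hxV, hxclV, ?_⟩, hWV⟩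
      · rw [card_erase_of_mem hb.1, hJcard]
        omega
      · exact rk_eq_card_of_subset_of_rk_eq_card (sdiff_subset_sdiff (Subset.refl _) hWV) hWcompl
      · exact fundC_eq_of_subset hWg hWrk hxcl hfund hxC hWV hVg hVrk hxclV
    have hinj : Set.InjOn (fun b => J.erase b) (J \ W : Finset α) := by
      intro b hb b' hb' hbb'
      rw [mem_coe, mem_sdiff] at hb hb'
      by_contra hne
      have : b ∈ J.erase b' := mem_erase.2 ⟨hne, hb.1⟩
      simp only at hbb'
      rw [← hbb'] at this
      exact (mem_erase.1 this).1 rfl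
    calc rk N (gr N) - 5 = (J \ W).card := by
          rw [card_sdiff_of_subset hWJ, hJcard, hWcard]
      _ ≤ (U.filter (fun V => W ⊆ V)).card := card_le_card_of_injOn _ hmaps hinj
  -- every unit `V` has at most `ρ − 5` demands below it: `W ↦ W ∖ C`, a point of `V ∖ C`
  have hco : ∀ V ∈ U, (D.filter (fun W => W ⊆ V)).card ≤ rk N (gr N) - 5 := by
    intro V hV
    rw [hU, mem_filter, mem_biIndepSets] at hV
    obtain ⟨⟨hVg, hVcard, hVrk, hVcompl⟩, hxV, hxclV, hfundV⟩ := hV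
    have hCV : C ⊆ V := hfundV ▸ fundC_subset V x
    have hmaps : ∀ W ∈ D.filter (fun W => W ⊆ V), W \ C ∈ powersetCard 1 (V \ C) := by
      intro W hW
      rw [mem_filter] at hW
      obtain ⟨hWD, hWV⟩ := hW
      rw [hD, mem_filter, mem_biIndepSets] at hWD
      obtain ⟨⟨_, hWcard, _, _⟩, _, _, hfund⟩ := hWD
      have hCW : C ⊆ W := hfund ▸ fundC_subset W x
      rw [mem_powersetCard]
      refine ⟨sdiff_subset_sdiff hWV (Subset.refl _), ?_⟩
      rw [card_sdiff_of_subset hCW, hWcard, hC]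
    have hinj : Set.InjOn (fun W => W \ C) (D.filter (fun W => W ⊆ V) : Finset (Finset α)) := by
      intro W hW W' hW' h
      rw [mem_coe, mem_filter, hD, mem_filter] at hW hW'
      have hCW : C ⊆ W := hW.1.2.2.2 ▸ fundC_subset W x
      have hCW' : C ⊆ W' := hW'.1.2.2.2 ▸ fundC_subset W' x
      rw [← sdiff_union_of_subset hCW, ← sdiff_union_of_subset hCW']
      simp only at h
      rw [h]
    calc (D.filter (fun W => W ⊆ V)).card ≤ (powersetCard 1 (V \ C)).card := card_le_card_of_injOn _ hmaps hinj
      _ = rk N (gr N) - 5 := by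
          rw [card_powersetCard, Nat.choose_one_right, card_sdiff_of_subset hCV, hVcard, hC]
          omega
  -- the double counting of the containment edges
  have h := sum_card_bipartiteAbove_eq_sum_card_bipartiteBelow (r := fun (W V : Finset α) => W ⊆ V) (s := D) (t := U)
  simp only [bipartiteAbove, bipartiteBelow] at h
  have h1 : D.card * (rk N (gr N) - 5) ≤ ∑ W ∈ D, (U.filter (fun V => W ⊆ V)).card := by
    rw [← smul_eq_mul]
    exact card_nsmul_le_sum _ _ _ hdeg
  have h2 : ∑ V ∈ U, (D.filter (fun W => W ⊆ V)).card ≤ U.card * (rk N (gr N) - 5) := by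
    rw [← smul_eq_mul]
    exact sum_le_card_nsmul _ _ _ hco
  have h3 : D.card * (rk N (gr N) - 5) ≤ U.card * (rk N (gr N) - 5) := by omega
  exact Nat.le_of_mul_le_mul_right h3 (by omega)


end Five

end PercRepro.Cogirth

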